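import Summits.BirchSwinnertonDyer.BirchSwinnertonDyer.Theorems.KolyvaginRoadThreePTSupplyOfMiddleExact
import Summits.BirchSwinnertonDyer.BirchSwinnertonDyer.Theorems.KolyvaginRoadThreeMethod2CruxOfBinders
import HarnessLib

/-!
# Route `KolyvaginRoadThree`, deciding crux `ZhangSharpFrameAtThreeHL` (item stmt-BirchSwinnertonDyer-19574):
# PT road, step (R) part 6 — S2-ENGINE and the METHOD line's TERMINAL CERTIFICATE with the named ∀-module Poitou–Tate
# fact replaced by Milne I 4.10(b) FOR `E[3]` ALONE (cell `bsd-stepL`, ACCEL seat `bsd-stepL-koly3b` g10;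
# `--supports stmt-BirchSwinnertonDyer-19574`, helper)

HONEST FRAMING. Composition only; 0 definitions, 0 named facts, 0 `sorry`, no instance attributes (the finiteness of
`E[3]` and the compactness of the local absolute Galois groups needed by the cup products are `Prop`-valued instance
binders); closes nothing (T7) — the crux is NOT claimed,
no stub is booked: everything is CONDITIONAL on the displayed hypotheses. PARTITION: O2@3 (B10) × A1 × crux 19574 × stub
PT's consumer chain — proves-glue (terminal-shape certificate).

WHAT. Twins of koly3b part XXVI (`ZhangSupply.triangulation_of_poitouTate`,
`ZhangSupply.stub_inductionOfLevelSystemsAtThree_of_poitouTate_of_rigidity`) and of the owner's `Method2CruxOfBinders` §2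
(`stub_inductionOfLevelSystemsAtThree_of_poitouTate`, `zhangSharpFrameAtThreeHL_of_routeBinders_of_poitouTate_of_bottom_of_
levelSystems`, koly g17) in which the hypothesis
`hPT : ∀ K, IsImaginaryQuadratic K → poitouTate_selmerStructure_duality K` (Poitou–Tate duality for Selmer structures on
EVERY finite module at EVERY level — skeleton v3.1's stub PT) is replaced by
`hE3 : ∀ E/ℚ, ∀ K imaginary quadratic, Milne *ADT* I Thm. 4.10(b) `Ker γ¹ ⊆ Im β¹` for the ONE module (E/K)[3] and THE
invariant maps `LocalInvariants.canonical K 3`, at every admissible S ⊇ ∞` — verbatim the conclusion shape of the owner's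
descent certificate `KolyvaginRoadThreePT.middleExact_canonical_of_descentData` (koly g19 p555478; its binders discharged by
koly g19–g20 except the instance `K' = K(E[3])^{Syl₃}`, in flight). RESULT `zhangSharpFrameAtThreeHL_of_routeBinders_of_
middleExact_of_bottom_of_levelSystems`: the crux decl BY NAME ⟸ `h₁ = PublishedInputsKolyThree` + `hCT3 =
ShimuraCasselsTateLevelInputs` + `hE3` + the TEXTS of S1 and S2-KS. So once the owner's instance lands, the METHOD line's
residual is EXACTLY {S1, S2-KS} ∪ the route's two existing binders — the v3.2 reshape (drop stub PT, or replace it by the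
text of `hE3`) needs no further glue. Nothing about `p = 3` is proved here; nothing is booked.

References: [cite: WZhang2014, §9 proof of Thm. 9.1, Thm. 9.2, Lemma 8.2, Lemma 8.4] [cite: McCallumLMS1991, Prop. 2.1,
Lemma 5.3] [cite: MilneADT2006, Ch. I, Thm. 4.10] [cite: GrossLMS1991, Prop. 8.1–8.2, 9.6]
[cite: Howard2004HeegnerKolyvagin, Thm. 2.1.11].
-/

noncomputable section

open scoped Classical Pointwise

namespace Summit.BirchSwinnertonDyer.Rank1Residual.X11b.Three.Koly.PTAt

open CategoryTheory WeierstrassCurve Field Function NumberField IsDedekindDomain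
open Literature.NumberTheory.EllipticCurves Literature.NumberTheory.EllipticCurves.ModularForms
  Literature.NumberTheory.GaloisRepresentations Module
open Literature.NumberTheory.GaloisRepresentations.DiscreteGaloisModule (mu MuCarrier tateDual localTatePairingZMod
  unramifiedSubgroup)
open Literature.NumberTheory.GaloisCohomology
open Summit.BirchSwinnertonDyer.Rank1Residual.X11b.Three.Koly.Method2
open Summit.BirchSwinnertonDyer.Rank1Residual.X11b.Three.Koly.Method2.KolyLocal
open Summit.BirchSwinnertonDyer.Rank1Residual.GaloisImage
open Summit.BirchSwinnertonDyer.Rank1Residual.X11b.Three.Koly.ZhangSupply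
open scoped ContRepresentation

variable (W : WeierstrassCurve ℚ) (K : Type) [Field K] [NumberField K] [W.IsElliptic] [W.IsGloballyMinimal]

/-! ## §1 The triangulation at one frame instance -/

/-- **Zhang's Lemma 8.4 triangulation at every good non-empty level, from Milne I 4.10(b) for `E[3]` alone and (IsoBound)
in cup-product currency** — twin of part XXVI's `triangulation_of_poitouTate` (`Method2.triangulation_of_supply` fed with
part 5's `hSupply_of_middleExact`). [cite: WZhang2014, Lemma 8.2, Lemma 8.4 (1)+(3)] [cite: MilneADT2006, Ch. I, Thm. 4.10] -/
theorem triangulation_of_middleExact [NeZero (W.conductorNorm ℤ)] [Module (ZMod 3) (V3 W K)]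
    (Dt : ModularParametrizationData W (W.conductorNorm ℤ)) (β : ℤ) (ι : K →+* ℂ) (c : K ≃ₐ[ℚ] K)
    (hK : IsImaginaryQuadratic K) (hmult : W.HasMultiplicativeReductionAtPrime 3)
    (hsurj : W.HasSurjectiveModNGaloisRep 3) (hd : NumberField.discr K < -4) (hc : c ≠ 1)
    [Finite ((W.baseChange K).geomTorsion ((3 ^ 1 : ℕ) : ℤ))]
    [∀ v : Place K, CompactSpace (absoluteGaloisGroup (Place.Completion v))]
    (hE3 : ∀ S : Finset (Place K), (∀ w : InfinitePlace K, (Sum.inl w : Place K) ∈ S) →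
      (∀ v : HeightOneSpectrum (𝓞 K), (Sum.inr v : Place K) ∉ S →
        (((3 ^ 1 : ℕ) : ℕ) : 𝓞 K) ∉ v.asIdeal ∧
          GaloisRep.IsUnramifiedAt v ((W.baseChange K).torsionGaloisModule ((3 ^ 1 : ℕ) : ℤ))) →
      ∀ t : Π v : Place K, galoisCohomology (((W.baseChange K).torsionGaloisModule ((3 ^ 1 : ℕ) : ℤ)).toLocal v) 1,
        (∀ y : galoisCohomology (((W.baseChange K).torsionGaloisModule ((3 ^ 1 : ℕ) : ℤ)).tateDual (3 ^ 1 : ℕ)) 1,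
          (∀ v : HeightOneSpectrum (𝓞 K), (Sum.inr v : Place K) ∉ S →
            galoisCohomology.localization (((W.baseChange K).torsionGaloisModule ((3 ^ 1 : ℕ) : ℤ)).tateDual
              (3 ^ 1 : ℕ)) (Sum.inr v) 1 y ∈
              unramifiedSubgroup (GaloisRep.toLocal v
                (((W.baseChange K).torsionGaloisModule ((3 ^ 1 : ℕ) : ℤ)).tateDual (3 ^ 1 : ℕ))) 1) →
          ∑ v ∈ S, localTatePairingZMod ((W.baseChange K).torsionGaloisModule ((3 ^ 1 : ℕ) : ℤ)) (3 ^ 1 : ℕ) v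
            (LocalInvariants.canonical K (3 ^ 1 : ℕ) v) (t v)
            (galoisCohomology.localization (((W.baseChange K).torsionGaloisModule ((3 ^ 1 : ℕ) : ℤ)).tateDual
              (3 ^ 1 : ℕ)) v 1 y) = 0) →
        ∃ x : galoisCohomology ((W.baseChange K).torsionGaloisModule ((3 ^ 1 : ℕ) : ℤ)) 1,
          (∀ v : HeightOneSpectrum (𝓞 K), (Sum.inr v : Place K) ∉ S →
            galoisCohomology.localization ((W.baseChange K).torsionGaloisModule ((3 ^ 1 : ℕ) : ℤ)) (Sum.inr v) 1 x ∈
              unramifiedSubgroup (GaloisRep.toLocal v ((W.baseChange K).torsionGaloisModule ((3 ^ 1 : ℕ) : ℤ))) 1) ∧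
          ∀ v ∈ S, galoisCohomology.localization ((W.baseChange K).torsionGaloisModule ((3 ^ 1 : ℕ) : ℤ)) v 1 x = t v)
    (S : LevelKolyvaginSystem W K Dt β ι c)
    (plK : {ℓ // Zhang2014.IsKolyvaginPrime (W.conductorNorm ℤ) W K 3 ℓ} → HeightOneSpectrum (𝓞 K))
    (hplK : ∀ ℓ, ((ℓ : ℕ) : 𝓞 K) ∈ (plK ℓ).asIdeal)
    (hboundCup : ∀ (e : geomTorsion (W.baseChange K) ((3 ^ 1 : ℕ) : ℤ) → geomTorsion (W.baseChange K) ((3 ^ 1 : ℕ) : ℤ) →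
          AlgebraicClosure K)
        (hμ : ∀ P Q, e P Q ^ (3 ^ 1) = 1) (hadd₁ : ∀ P₁ P₂ Q, e (P₁ + P₂) Q = e P₁ Q * e P₂ Q)
        (hadd₂ : ∀ P Q₁ Q₂, e P (Q₁ + Q₂) = e P Q₁ * e P Q₂) (_halt : ∀ Q, e Q Q = 1)
        (_hnondeg : ∀ Q, (∀ P, e P Q = 1) → Q = 0)
        (hgal : ∀ (σ : absoluteGaloisGroup K) (P Q : geomTorsion (W.baseChange K) ((3 ^ 1 : ℕ) : ℤ)),
          σ • e P Q = e (σ • P) (σ • Q))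
        (ℓ : {ℓ // Zhang2014.IsKolyvaginPrime (W.conductorNorm ℤ) W K 3 ℓ}) (s : Bool) (x y : V3 W K),
      conjAct W c ((3 ^ 1 : ℕ) : ℤ) x = sgn s • x → conjAct W c ((3 ^ 1 : ℕ) : ℤ) y = sgn s • y →
      (weilContPairingLocal (W.baseChange K) (3 ^ 1) e hμ hadd₁ hadd₂ hgal (Sum.inr (plK ℓ))).cupProduct
        (galoisCohomology.localization ((W.baseChange K).torsionGaloisModule ((3 ^ 1 : ℕ) : ℤ)) (Sum.inr (plK ℓ)) 1 x)
        (galoisCohomology.localization ((W.baseChange K).torsionGaloisModule ((3 ^ 1 : ℕ) : ℤ)) (Sum.inr (plK ℓ)) 1 x)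
          = 0 →
      (weilContPairingLocal (W.baseChange K) (3 ^ 1) e hμ hadd₁ hadd₂ hgal (Sum.inr (plK ℓ))).cupProduct
        (galoisCohomology.localization ((W.baseChange K).torsionGaloisModule ((3 ^ 1 : ℕ) : ℤ)) (Sum.inr (plK ℓ)) 1 x)
        (galoisCohomology.localization ((W.baseChange K).torsionGaloisModule ((3 ^ 1 : ℕ) : ℤ)) (Sum.inr (plK ℓ)) 1 y)
          = 0 →
      (weilContPairingLocal (W.baseChange K) (3 ^ 1) e hμ hadd₁ hadd₂ hgal (Sum.inr (plK ℓ))).cupProduct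
        (galoisCohomology.localization ((W.baseChange K).torsionGaloisModule ((3 ^ 1 : ℕ) : ℤ)) (Sum.inr (plK ℓ)) 1 y)
        (galoisCohomology.localization ((W.baseChange K).torsionGaloisModule ((3 ^ 1 : ℕ) : ℤ)) (Sum.inr (plK ℓ)) 1 x)
          = 0 →
      (weilContPairingLocal (W.baseChange K) (3 ^ 1) e hμ hadd₁ hadd₂ hgal (Sum.inr (plK ℓ))).cupProduct
        (galoisCohomology.localization ((W.baseChange K).torsionGaloisModule ((3 ^ 1 : ℕ) : ℤ)) (Sum.inr (plK ℓ)) 1 y)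
        (galoisCohomology.localization ((W.baseChange K).torsionGaloisModule ((3 ^ 1 : ℕ) : ℤ)) (Sum.inr (plK ℓ)) 1 y)
          = 0 →
      x ∉ (W.baseChange K).torsionLocalKer ((plK ℓ).adicCompletion K) ((3 ^ 1 : ℕ) : ℤ) →
      ∃ a : ℤ, y - a • x ∈ (W.baseChange K).torsionLocalKer ((plK ℓ).adicCompletion K) ((3 ^ 1 : ℕ) : ℤ))
    (n : Finset {q // IsUAdmissiblePrime W K q}) (hg : GoodLevel W K n) (hn : n.Nonempty) (hne : ∃ m, S.κ m n ≠ 0) :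
    ∃ (s : Bool) (d : ℕ), finrank (ZMod 3) (SelQ W K c n s) = d + 1 ∧
      SelQ W K c n s = SelRelQ W K c n (baseLocusQ W K S.κ n) s ∧
      FiniteDimensional (ZMod 3) (SelRelQ W K c n (baseLocusQ W K S.κ n) (!s)) ∧
      finrank (ZMod 3) (SelRelQ W K c n (baseLocusQ W K S.κ n) (!s)) ≤ d := by
  obtain ⟨plU, hplU⟩ := exists_placesAbove_uAdmissible W K
  exact triangulation_of_supply W K Dt β ι c hK hmult hsurj hc S plK plU hplK hplU n hg hn hne
    (hSupply_of_middleExact W K ι c hK hd hc hE3 plK hplK hboundCup n hg hn)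

/-! ## §2 S2-ENGINE, closed form -/

/-- **S2-ENGINE `Method2.stub_inductionOfLevelSystemsAtThree` (skeleton v3.1, text VERBATIM as the conclusion) FROM Milne I
4.10(b) for `(E/K)[3]` at imaginary quadratic `K` (`hE3`, for every elliptic `E/ℚ`) and the local line-rigidity at Kolyvagin
primes (`hRig`, cup-product currency; its two inner instance binders are the `Prop`-valued finiteness of `E[3]` and
compactness of the local Galois groups, automatic wherever the series' local instances are open)** — twin of part XXVI's
`stub_inductionOfLevelSystemsAtThree_of_poitouTate_of_rigidity` (the OWNER's `inductionOfLevelSystems_of_triangulation` ∘ §1).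
CONDITIONAL on `hE3`, `hRig`; nothing is booked. [cite: WZhang2014, §9 proof of Thm. 9.1, Lemma 8.2, Lemma 8.4]
[cite: MilneADT2006, Ch. I, Thm. 4.10] [cite: GrossLMS1991, Prop. 8.1–8.2, 9.6] -/
theorem stub_inductionOfLevelSystemsAtThree_of_middleExact_of_rigidity
    (hE3 : ∀ (W : WeierstrassCurve ℚ) [W.IsElliptic] (K : Type) [Field K] [NumberField K]
      [Finite ((W.baseChange K).geomTorsion ((3 ^ 1 : ℕ) : ℤ))], IsImaginaryQuadratic K →
      ∀ S : Finset (Place K), (∀ w : InfinitePlace K, (Sum.inl w : Place K) ∈ S) →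
        (∀ v : HeightOneSpectrum (𝓞 K), (Sum.inr v : Place K) ∉ S →
          (((3 ^ 1 : ℕ) : ℕ) : 𝓞 K) ∉ v.asIdeal ∧
            GaloisRep.IsUnramifiedAt v ((W.baseChange K).torsionGaloisModule ((3 ^ 1 : ℕ) : ℤ))) →
        ∀ t : Π v : Place K, galoisCohomology (((W.baseChange K).torsionGaloisModule ((3 ^ 1 : ℕ) : ℤ)).toLocal v) 1,
          (∀ y : galoisCohomology (((W.baseChange K).torsionGaloisModule ((3 ^ 1 : ℕ) : ℤ)).tateDual (3 ^ 1 : ℕ)) 1,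
            (∀ v : HeightOneSpectrum (𝓞 K), (Sum.inr v : Place K) ∉ S →
              galoisCohomology.localization (((W.baseChange K).torsionGaloisModule ((3 ^ 1 : ℕ) : ℤ)).tateDual
                (3 ^ 1 : ℕ)) (Sum.inr v) 1 y ∈
                unramifiedSubgroup (GaloisRep.toLocal v
                  (((W.baseChange K).torsionGaloisModule ((3 ^ 1 : ℕ) : ℤ)).tateDual (3 ^ 1 : ℕ))) 1) →
            ∑ v ∈ S, localTatePairingZMod ((W.baseChange K).torsionGaloisModule ((3 ^ 1 : ℕ) : ℤ)) (3 ^ 1 : ℕ) v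
              (LocalInvariants.canonical K (3 ^ 1 : ℕ) v) (t v)
              (galoisCohomology.localization (((W.baseChange K).torsionGaloisModule ((3 ^ 1 : ℕ) : ℤ)).tateDual
                (3 ^ 1 : ℕ)) v 1 y) = 0) →
          ∃ x : galoisCohomology ((W.baseChange K).torsionGaloisModule ((3 ^ 1 : ℕ) : ℤ)) 1,
            (∀ v : HeightOneSpectrum (𝓞 K), (Sum.inr v : Place K) ∉ S →
              galoisCohomology.localization ((W.baseChange K).torsionGaloisModule ((3 ^ 1 : ℕ) : ℤ)) (Sum.inr v) 1 x ∈
                unramifiedSubgroup (GaloisRep.toLocal v ((W.baseChange K).torsionGaloisModule ((3 ^ 1 : ℕ) : ℤ))) 1) ∧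
            ∀ v ∈ S, galoisCohomology.localization ((W.baseChange K).torsionGaloisModule ((3 ^ 1 : ℕ) : ℤ)) v 1 x = t v)
    (hRig : ∀ (W : WeierstrassCurve ℚ) [W.IsElliptic] [W.IsGloballyMinimal] (K : Type) [Field K] [NumberField K]
      [Finite ((W.baseChange K).geomTorsion ((3 ^ 1 : ℕ) : ℤ))]
      [∀ v : Place K, CompactSpace (absoluteGaloisGroup (Place.Completion v))],
      IsImaginaryQuadratic K → W.HasSurjectiveModNGaloisRep 3 → ∀ (c : K ≃ₐ[ℚ] K), c ≠ 1 →
      ∀ (e : geomTorsion (W.baseChange K) ((3 ^ 1 : ℕ) : ℤ) → geomTorsion (W.baseChange K) ((3 ^ 1 : ℕ) : ℤ) →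
          AlgebraicClosure K)
        (hμ : ∀ P Q, e P Q ^ (3 ^ 1) = 1) (hadd₁ : ∀ P₁ P₂ Q, e (P₁ + P₂) Q = e P₁ Q * e P₂ Q)
        (hadd₂ : ∀ P Q₁ Q₂, e P (Q₁ + Q₂) = e P Q₁ * e P Q₂) (_halt : ∀ Q, e Q Q = 1)
        (_hnondeg : ∀ Q, (∀ P, e P Q = 1) → Q = 0)
        (hgal : ∀ (σ : absoluteGaloisGroup K) (P Q : geomTorsion (W.baseChange K) ((3 ^ 1 : ℕ) : ℤ)),
          σ • e P Q = e (σ • P) (σ • Q))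
        {ℓ : ℕ} (hℓ : Zhang2014.IsKolyvaginPrime (W.conductorNorm ℤ) W K 3 ℓ) (v : HeightOneSpectrum (𝓞 K))
        (_hv : (ℓ : 𝓞 K) ∈ v.asIdeal) (s : Bool) (x y : V3 W K),
      conjAct W c ((3 ^ 1 : ℕ) : ℤ) x = sgn s • x → conjAct W c ((3 ^ 1 : ℕ) : ℤ) y = sgn s • y →
      (weilContPairingLocal (W.baseChange K) (3 ^ 1) e hμ hadd₁ hadd₂ hgal (Sum.inr v)).cupProduct
        (galoisCohomology.localization ((W.baseChange K).torsionGaloisModule ((3 ^ 1 : ℕ) : ℤ)) (Sum.inr v) 1 x)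
        (galoisCohomology.localization ((W.baseChange K).torsionGaloisModule ((3 ^ 1 : ℕ) : ℤ)) (Sum.inr v) 1 x) = 0 →
      (weilContPairingLocal (W.baseChange K) (3 ^ 1) e hμ hadd₁ hadd₂ hgal (Sum.inr v)).cupProduct
        (galoisCohomology.localization ((W.baseChange K).torsionGaloisModule ((3 ^ 1 : ℕ) : ℤ)) (Sum.inr v) 1 x)
        (galoisCohomology.localization ((W.baseChange K).torsionGaloisModule ((3 ^ 1 : ℕ) : ℤ)) (Sum.inr v) 1 y) = 0 →
      (weilContPairingLocal (W.baseChange K) (3 ^ 1) e hμ hadd₁ hadd₂ hgal (Sum.inr v)).cupProduct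
        (galoisCohomology.localization ((W.baseChange K).torsionGaloisModule ((3 ^ 1 : ℕ) : ℤ)) (Sum.inr v) 1 y)
        (galoisCohomology.localization ((W.baseChange K).torsionGaloisModule ((3 ^ 1 : ℕ) : ℤ)) (Sum.inr v) 1 x) = 0 →
      (weilContPairingLocal (W.baseChange K) (3 ^ 1) e hμ hadd₁ hadd₂ hgal (Sum.inr v)).cupProduct
        (galoisCohomology.localization ((W.baseChange K).torsionGaloisModule ((3 ^ 1 : ℕ) : ℤ)) (Sum.inr v) 1 y)
        (galoisCohomology.localization ((W.baseChange K).torsionGaloisModule ((3 ^ 1 : ℕ) : ℤ)) (Sum.inr v) 1 y) = 0 →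
      x ∉ (W.baseChange K).torsionLocalKer (v.adicCompletion K) ((3 ^ 1 : ℕ) : ℤ) →
      ∃ a : ℤ, y - a • x ∈ (W.baseChange K).torsionLocalKer (v.adicCompletion K) ((3 ^ 1 : ℕ) : ℤ)) :
    ∀ (W : WeierstrassCurve ℚ) [W.IsElliptic] [W.IsGloballyMinimal] [NeZero (W.conductorNorm ℤ)] (K : Type)
      [Field K] [NumberField K] (Dt : ModularParametrizationData W (W.conductorNorm ℤ)) (β : ℤ) (ι : K →+* ℂ),
      Summit.BirchSwinnertonDyer.Rank1Residual.ClassX11b W 3 → W.HasMultiplicativeReductionAtPrime 3 →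
      Rank1Residual.Surj W 3 → Rank1Residual.Ram W 3 → ¬ 3 ∣ W.tamagawaProduct → IsImaginaryQuadratic K →
      Odd (NumberField.discr K) → SatisfiesHeegnerHypothesis (W.conductorNorm ℤ) K →
      (W.quadraticTwist (NumberField.discr K : ℚ)).entireLFunction 1 ≠ 0 → NumberField.discr K ≠ -3 →
      (4 * (W.conductorNorm ℤ : ℤ)) ∣ β ^ 2 - NumberField.discr K → ¬ (3 : ℤ) ∣ Dt.c →
      ∀ (c : K ≃ₐ[ℚ] K), c ≠ 1 → ∀ [Module (ZMod 3) (V3 W K)],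
      LevelKolyvaginSystem W K Dt β ι c →
      -- (A1) at the frame (stub A's body, verbatim) as HYPOTHESIS
      (∀ (n : Finset {q // IsUAdmissiblePrime W K q}) (μ : Bool) (x : V3 W K),
        GoodLevel W K n → x ∈ SelQ W K c n μ → x ≠ 0 →
        ∃ q : {q // IsUAdmissiblePrime W K q}, q ∉ n ∧ GoodLevel W K (insert q n) ∧
          x ∉ SelQ W K c (insert q n) μ ∧
          SelQ W K c (insert q n) μ ≤ SelQ W K c n μ ∧
          finrank (ZMod 3) (SelQ W K c (insert q n) μ) + 1 = finrank (ZMod 3) (SelQ W K c n μ) ∧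
          SelQ W K c (insert q n) (!μ) = SelQ W K c n (!μ)) →
      Odd (finrank (ZMod 3)
        (AddSubgroup.toZModSubmodule 3 (selmerGroup (W.baseChange K) ((3 ^ 1 : ℕ) : ℤ)))) →
      3 ≤ finrank (ZMod 3)
        (AddSubgroup.toZModSubmodule 3 (selmerGroup (W.baseChange K) ((3 ^ 1 : ℕ) : ℤ))) →
      ∃ (n : ℕ) (d : KolyvaginHeegnerData Dt β ι n),
        KolyvaginDescent.KolSupp (Zhang2014.IsKolyvaginPrime (W.conductorNorm ℤ) W K 3) n ∧
          d.kolyvaginClass Nat.prime_three 1 ≠ 0 := by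
  refine Method2EngineOfTriangulation.inductionOfLevelSystems_of_triangulation ?_
  intro W _ _ _ K _ _ Dt β ι hX hmult hsurj _hRam _htam hK _hodd hH _hLt _h3 hβ _hc c hc1 _ S n hg hn _hev hne
  have hd : NumberField.discr K < -4 := discr_lt_neg_four_of_frame W K hX hK hH hβ
  obtain ⟨plK, hplK⟩ := exists_placesAbove_kolyvagin W K
  haveI : Finite ((W.baseChange K).geomTorsion ((3 ^ 1 : ℕ) : ℤ)) := finite_geomTorsion_of_neZero (W.baseChange K) (3 ^ 1)
  haveI : ∀ v : Place K, CompactSpace (absoluteGaloisGroup (Place.Completion v)) :=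
    fun v ↦ absoluteGaloisGroup_compactSpace _
  exact triangulation_of_middleExact W K Dt β ι c hK hmult hsurj hd hc1 (hE3 W K hK) S plK hplK
    (fun e hμ hadd₁ hadd₂ halt hnondeg hgal ℓ s x y hxs hys h11 h12 h21 h22 hx0 ↦
      hRig W K hK hsurj c hc1 e hμ hadd₁ hadd₂ halt hnondeg hgal ℓ.2 (plK ℓ) (hplK ℓ) s x y hxs hys h11 h12
        h21 h22 hx0)
    n hg hn hne

/-- **S2-ENGINE's registered text from Milne I 4.10(b) for `E[3]` ALONE** — §2 with its local line-rigidity `hRig` fed by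
zhang3-p1 g10's `KolyLocal.sub_zsmul_mem_torsionLocalKer_of_isotropic` (as in the owner's
`Method2CruxOfBinders.stub_inductionOfLevelSystemsAtThree_of_poitouTate`). CONDITIONAL on `hE3`; nothing is booked.
[cite: WZhang2014, §9 proof of Thm. 9.1, Lemma 8.2, Lemma 8.4] [cite: GrossLMS1991, Prop. 8.1–8.2, 9.6]
[cite: MilneADT2006, Ch. I, Thm. 4.10] -/
theorem stub_inductionOfLevelSystemsAtThree_of_middleExact
    (hE3 : ∀ (W : WeierstrassCurve ℚ) [W.IsElliptic] (K : Type) [Field K] [NumberField K]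
      [Finite ((W.baseChange K).geomTorsion ((3 ^ 1 : ℕ) : ℤ))], IsImaginaryQuadratic K →
      ∀ S : Finset (Place K), (∀ w : InfinitePlace K, (Sum.inl w : Place K) ∈ S) →
        (∀ v : HeightOneSpectrum (𝓞 K), (Sum.inr v : Place K) ∉ S →
          (((3 ^ 1 : ℕ) : ℕ) : 𝓞 K) ∉ v.asIdeal ∧
            GaloisRep.IsUnramifiedAt v ((W.baseChange K).torsionGaloisModule ((3 ^ 1 : ℕ) : ℤ))) →
        ∀ t : Π v : Place K, galoisCohomology (((W.baseChange K).torsionGaloisModule ((3 ^ 1 : ℕ) : ℤ)).toLocal v) 1,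
          (∀ y : galoisCohomology (((W.baseChange K).torsionGaloisModule ((3 ^ 1 : ℕ) : ℤ)).tateDual (3 ^ 1 : ℕ)) 1,
            (∀ v : HeightOneSpectrum (𝓞 K), (Sum.inr v : Place K) ∉ S →
              galoisCohomology.localization (((W.baseChange K).torsionGaloisModule ((3 ^ 1 : ℕ) : ℤ)).tateDual
                (3 ^ 1 : ℕ)) (Sum.inr v) 1 y ∈
                unramifiedSubgroup (GaloisRep.toLocal v
                  (((W.baseChange K).torsionGaloisModule ((3 ^ 1 : ℕ) : ℤ)).tateDual (3 ^ 1 : ℕ))) 1) →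
            ∑ v ∈ S, localTatePairingZMod ((W.baseChange K).torsionGaloisModule ((3 ^ 1 : ℕ) : ℤ)) (3 ^ 1 : ℕ) v
              (LocalInvariants.canonical K (3 ^ 1 : ℕ) v) (t v)
              (galoisCohomology.localization (((W.baseChange K).torsionGaloisModule ((3 ^ 1 : ℕ) : ℤ)).tateDual
                (3 ^ 1 : ℕ)) v 1 y) = 0) →
          ∃ x : galoisCohomology ((W.baseChange K).torsionGaloisModule ((3 ^ 1 : ℕ) : ℤ)) 1,
            (∀ v : HeightOneSpectrum (𝓞 K), (Sum.inr v : Place K) ∉ S →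
              galoisCohomology.localization ((W.baseChange K).torsionGaloisModule ((3 ^ 1 : ℕ) : ℤ)) (Sum.inr v) 1 x ∈
                unramifiedSubgroup (GaloisRep.toLocal v ((W.baseChange K).torsionGaloisModule ((3 ^ 1 : ℕ) : ℤ))) 1) ∧
            ∀ v ∈ S, galoisCohomology.localization ((W.baseChange K).torsionGaloisModule ((3 ^ 1 : ℕ) : ℤ)) v 1 x = t v) :
    ∀ (W : WeierstrassCurve ℚ) [W.IsElliptic] [W.IsGloballyMinimal] [NeZero (W.conductorNorm ℤ)] (K : Type)
      [Field K] [NumberField K] (Dt : ModularParametrizationData W (W.conductorNorm ℤ)) (β : ℤ) (ι : K →+* ℂ),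
      Summit.BirchSwinnertonDyer.Rank1Residual.ClassX11b W 3 → W.HasMultiplicativeReductionAtPrime 3 →
      Rank1Residual.Surj W 3 → Rank1Residual.Ram W 3 → ¬ 3 ∣ W.tamagawaProduct → IsImaginaryQuadratic K →
      Odd (NumberField.discr K) → SatisfiesHeegnerHypothesis (W.conductorNorm ℤ) K →
      (W.quadraticTwist (NumberField.discr K : ℚ)).entireLFunction 1 ≠ 0 → NumberField.discr K ≠ -3 →
      (4 * (W.conductorNorm ℤ : ℤ)) ∣ β ^ 2 - NumberField.discr K → ¬ (3 : ℤ) ∣ Dt.c →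
      ∀ (c : K ≃ₐ[ℚ] K), c ≠ 1 → ∀ [Module (ZMod 3) (V3 W K)],
      LevelKolyvaginSystem W K Dt β ι c →
      (∀ (n : Finset {q // IsUAdmissiblePrime W K q}) (μ : Bool) (x : V3 W K),
        GoodLevel W K n → x ∈ SelQ W K c n μ → x ≠ 0 →
        ∃ q : {q // IsUAdmissiblePrime W K q}, q ∉ n ∧ GoodLevel W K (insert q n) ∧
          x ∉ SelQ W K c (insert q n) μ ∧
          SelQ W K c (insert q n) μ ≤ SelQ W K c n μ ∧
          finrank (ZMod 3) (SelQ W K c (insert q n) μ) + 1 = finrank (ZMod 3) (SelQ W K c n μ) ∧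
          SelQ W K c (insert q n) (!μ) = SelQ W K c n (!μ)) →
      Odd (finrank (ZMod 3)
        (AddSubgroup.toZModSubmodule 3 (selmerGroup (W.baseChange K) ((3 ^ 1 : ℕ) : ℤ)))) →
      3 ≤ finrank (ZMod 3)
        (AddSubgroup.toZModSubmodule 3 (selmerGroup (W.baseChange K) ((3 ^ 1 : ℕ) : ℤ))) →
      ∃ (n : ℕ) (d : KolyvaginHeegnerData Dt β ι n),
        KolyvaginDescent.KolSupp (Zhang2014.IsKolyvaginPrime (W.conductorNorm ℤ) W K 3) n ∧
          d.kolyvaginClass Nat.prime_three 1 ≠ 0 :=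
  stub_inductionOfLevelSystemsAtThree_of_middleExact_of_rigidity hE3
    (fun W _ _ K _ _ _ _ hK hsurj _c hc e hμ hadd₁ hadd₂ halt hnondeg hgal _ℓ hℓ v hv s _x _y hxs hys h11 h12 h21 h22
        hx0 ↦
      KolyLocal.sub_zsmul_mem_torsionLocalKer_of_isotropic W K hK hsurj hc e hμ hadd₁ hadd₂ halt hnondeg hgal hℓ v hv s
        hxs hys h11 h12 h21 h22 hx0)

/-! ## §3 The terminal certificate of the METHOD line with stub PT replaced by Milne I 4.10(b) for `E[3]` -/

/-- **THE TERMINAL CERTIFICATE OF THE METHOD LINE, E[3]-SPECIFIC FORM.** The crux `ZhangSharpFrameAtThreeHL` BY NAME from the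
two route support decls `PublishedInputsKolyThree` (binder `h₁` of `closes`) and `ShimuraCasselsTateLevelInputs` (binder
`hCT3`), Milne *ADT* I Thm. 4.10(b) for `(E/K)[3]` and THE invariant maps at level `3` for every elliptic `E/ℚ` and every
imaginary quadratic `K` (`hE3` — replacing skeleton v3.1's stub PT = the ∀-module named fact
`poitouTate_selmerStructure_duality`), and the TEXTS of the two open stubs S1 (`stub_bottomRankOneAtThree`) and S2-KS
(`stub_levelKolyvaginSystemsAtThree`). Twin of the owner's
`Method2CruxOfBinders.zhangSharpFrameAtThreeHL_of_routeBinders_of_poitouTate_of_bottom_of_levelSystems` (koly g17) with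
S2-ENGINE from the previous theorem. So once `hE3` is a theorem (owner's PT road: dévissage + descent, instance
`K(E[3])^{Syl₃}` in flight) the METHOD line's residual is EXACTLY {S1, S2-KS}. CONDITIONAL; nothing is booked; no class of
O2@3 moves. [cite: WZhang2014, §9 proof of Thm. 9.1, Thm. 9.2, Lemma 8.2] [cite: McCallumLMS1991, Prop. 2.1, §5 Cor. 5.6]
[cite: MilneADT2006, Ch. I, Thm. 4.10] -/
theorem zhangSharpFrameAtThreeHL_of_routeBinders_of_middleExact_of_bottom_of_levelSystems
    (h₁ : Summit.BirchSwinnertonDyer.BirchSwinnertonDyer.Theses.KolyvaginRoadThree.PublishedInputsKolyThree)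
    (hCT3 : Summit.BirchSwinnertonDyer.BirchSwinnertonDyer.Theses.KolyvaginRoadThree.ShimuraCasselsTateLevelInputs)
    (hE3 : ∀ (W : WeierstrassCurve ℚ) [W.IsElliptic] (K : Type) [Field K] [NumberField K]
      [Finite ((W.baseChange K).geomTorsion ((3 ^ 1 : ℕ) : ℤ))], IsImaginaryQuadratic K →
      ∀ S : Finset (Place K), (∀ w : InfinitePlace K, (Sum.inl w : Place K) ∈ S) →
        (∀ v : HeightOneSpectrum (𝓞 K), (Sum.inr v : Place K) ∉ S →
          (((3 ^ 1 : ℕ) : ℕ) : 𝓞 K) ∉ v.asIdeal ∧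
            GaloisRep.IsUnramifiedAt v ((W.baseChange K).torsionGaloisModule ((3 ^ 1 : ℕ) : ℤ))) →
        ∀ t : Π v : Place K, galoisCohomology (((W.baseChange K).torsionGaloisModule ((3 ^ 1 : ℕ) : ℤ)).toLocal v) 1,
          (∀ y : galoisCohomology (((W.baseChange K).torsionGaloisModule ((3 ^ 1 : ℕ) : ℤ)).tateDual (3 ^ 1 : ℕ)) 1,
            (∀ v : HeightOneSpectrum (𝓞 K), (Sum.inr v : Place K) ∉ S →
              galoisCohomology.localization (((W.baseChange K).torsionGaloisModule ((3 ^ 1 : ℕ) : ℤ)).tateDual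
                (3 ^ 1 : ℕ)) (Sum.inr v) 1 y ∈
                unramifiedSubgroup (GaloisRep.toLocal v
                  (((W.baseChange K).torsionGaloisModule ((3 ^ 1 : ℕ) : ℤ)).tateDual (3 ^ 1 : ℕ))) 1) →
            ∑ v ∈ S, localTatePairingZMod ((W.baseChange K).torsionGaloisModule ((3 ^ 1 : ℕ) : ℤ)) (3 ^ 1 : ℕ) v
              (LocalInvariants.canonical K (3 ^ 1 : ℕ) v) (t v)
              (galoisCohomology.localization (((W.baseChange K).torsionGaloisModule ((3 ^ 1 : ℕ) : ℤ)).tateDual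
                (3 ^ 1 : ℕ)) v 1 y) = 0) →
          ∃ x : galoisCohomology ((W.baseChange K).torsionGaloisModule ((3 ^ 1 : ℕ) : ℤ)) 1,
            (∀ v : HeightOneSpectrum (𝓞 K), (Sum.inr v : Place K) ∉ S →
              galoisCohomology.localization ((W.baseChange K).torsionGaloisModule ((3 ^ 1 : ℕ) : ℤ)) (Sum.inr v) 1 x ∈
                unramifiedSubgroup (GaloisRep.toLocal v ((W.baseChange K).torsionGaloisModule ((3 ^ 1 : ℕ) : ℤ))) 1) ∧
            ∀ v ∈ S, galoisCohomology.localization ((W.baseChange K).torsionGaloisModule ((3 ^ 1 : ℕ) : ℤ)) v 1 x = t v)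
    (hS1 :
      ∀ (W : WeierstrassCurve ℚ) [W.IsElliptic] [W.IsGloballyMinimal] [NeZero (W.conductorNorm ℤ)] (K : Type)
        [Field K] [NumberField K] (Dt : ModularParametrizationData W (W.conductorNorm ℤ)) (β : ℤ) (ι : K →+* ℂ),
        Summit.BirchSwinnertonDyer.Rank1Residual.ClassX11b W 3 → W.HasMultiplicativeReductionAtPrime 3 →
        Rank1Residual.Surj W 3 → Rank1Residual.Ram W 3 → ¬ 3 ∣ W.tamagawaProduct → IsImaginaryQuadratic K →
        Odd (NumberField.discr K) → SatisfiesHeegnerHypothesis (W.conductorNorm ℤ) K →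
        (W.quadraticTwist (NumberField.discr K : ℚ)).entireLFunction 1 ≠ 0 → NumberField.discr K ≠ -3 →
        (4 * (W.conductorNorm ℤ : ℤ)) ∣ β ^ 2 - NumberField.discr K → ¬ (3 : ℤ) ∣ Dt.c →
        ∀ [Module (ZMod 3) (V3 W K)],
        finrank (ZMod 3)
          (AddSubgroup.toZModSubmodule 3 (selmerGroup (W.baseChange K) ((3 ^ 1 : ℕ) : ℤ))) = 1 →
        ∃ d : KolyvaginHeegnerData Dt β ι 1, d.kolyvaginClass Nat.prime_three 1 ≠ 0)
    (hKS :
      ∀ (W : WeierstrassCurve ℚ) [W.IsElliptic] [W.IsGloballyMinimal] [NeZero (W.conductorNorm ℤ)] (K : Type)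
        [Field K] [NumberField K] (Dt : ModularParametrizationData W (W.conductorNorm ℤ)) (β : ℤ) (ι : K →+* ℂ),
        Summit.BirchSwinnertonDyer.Rank1Residual.ClassX11b W 3 → W.HasMultiplicativeReductionAtPrime 3 →
        Rank1Residual.Surj W 3 → Rank1Residual.Ram W 3 → ¬ 3 ∣ W.tamagawaProduct → IsImaginaryQuadratic K →
        Odd (NumberField.discr K) → SatisfiesHeegnerHypothesis (W.conductorNorm ℤ) K →
        (W.quadraticTwist (NumberField.discr K : ℚ)).entireLFunction 1 ≠ 0 → NumberField.discr K ≠ -3 →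
        (4 * (W.conductorNorm ℤ : ℤ)) ∣ β ^ 2 - NumberField.discr K → ¬ (3 : ℤ) ∣ Dt.c →
        ∀ (c : K ≃ₐ[ℚ] K), c ≠ 1 → ∀ [Module (ZMod 3) (V3 W K)],
        Nonempty (LevelKolyvaginSystem W K Dt β ι c)) :
    Summit.BirchSwinnertonDyer.BirchSwinnertonDyer.Theses.KolyvaginRoadThree.ZhangSharpFrameAtThreeHL :=
  Method2CruxOfBinders.zhangSharpFrameAtThreeHL_of_routeBinders_of_bottom_of_levelSystems h₁ hCT3 hS1 hKS
    (stub_inductionOfLevelSystemsAtThree_of_middleExact hE3)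

end Summit.BirchSwinnertonDyer.Rank1Residual.X11b.Three.Koly.PTAt

end
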